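import Mathlib.Analysis.Calculus.LineDeriv.IntegrationByParts
import Mathlib.Geometry.Manifold.PartitionOfUnity
import Literature.Geometry.Lorentzian.VolumeChartIntegral
import Literature.Geometry.Lorentzian.VolumeProofs
import Literature.Geometry.Lorentzian.ChartLaplacian
import Literature.Analysis.Calculus.CoordinateLaplacian
import HarnessLib

/-!
# Green's first identity on a closed Riemannian manifold:
# `∫_N u Δ_h f dμ_h = −∫_N h⁻¹(du, df) dμ_h`

For a compact Riemannian manifold `(N, h)` without boundary, modelled on `ℝ^m`
(`EuclideanSpace ℝ (Fin m)`, boundaryless model with corners `I`, `C^∞` structure), with the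
tree's intrinsic objects — the Laplace–Beltrami operator `Δ_h f = tr_h Hess f`
(`PseudoRiemannianMetric.dalembertian` of `LeviCivita.lean`), the inverse metric on covectors
`h⁻¹(α, β)` (`innerDual`) and the Riemannian measure `μ_h` (`riemannianMeasure` of `Volume.lean`,
the Euclidean-normalised `m`-dimensional Hausdorff measure of the length metric) — we PROVE

* `integral_mul_dalembertian_eq_neg_integral_innerDual` — **Green's first identity**
  `∫_N u Δ_h f dμ_h = −∫_N h⁻¹(du, df) dμ_h` for `u ∈ C¹(N)`, `f ∈ C²(N)`
  (Lee, *Introduction to Riemannian Manifolds* (2018), Problem 2-23 (a), with `∂N = ∅`);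
* `integral_dalembertian_eq_zero` — `∫_N Δ_h f dμ_h = 0` (Lee 2018, Problem 2-23 (c));
* `integral_mul_dalembertian_inv_eq`, `integral_mul_dalembertian_inv_nonneg` —
  `∫_N H Δ_h(H⁻¹) dμ_h = ∫_N H⁻² h⁻¹(dH, dH) dμ_h ≥ 0` for `H ∈ C²(N)` nowhere zero: the
  integration by parts `∫ −2HΔ(H⁻¹) = −2∫|DH|²/H²` of Huisken–Ilmanen's Monotonicity Calculation
  (J. Differential Geom. 59 (2001), §5), i.e. hypothesis (F4) of
  `IsClassicalIMCF.hasDerivAt_sqMeanCurvatureIntegral_le` (`GerochMonotonicityProofs.lean`) for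
  leaves with `C²` mean curvature;
* `integral_mul_dalembertian_of_tsupport_subset` — the identity for `u` supported in one chart
  domain, which carries the whole analysis.

Mathlib has neither the divergence theorem nor Green's identities on manifolds. The proof is the
classical one in local coordinates, assembled from the tree:

1. *Localisation.* A finite subcover of the compact `N` by chart domains and a smooth partition
   of unity subordinate to it (Mathlib's `SmoothPartitionOfUnity.exists_isSubordinate`) reduce,
   by linearity of `u ↦ ∫ uΔf` and of `u ↦ du` (`mvfderiv_finset_sum`), to `u` with
   `tsupport u` inside the chart domain of a point `x` (`φ = extChartAt I x`, target `T`).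
2. *The measure in the chart* (`VolumeChartIntegral.lean`, from Federer's identification of the
   Hausdorff measure with the Riemannian volume proved in `VolumeChartFormula.lean`):
   `∫_N F dμ_h = ∫_T √(det h_{ij}) F ∘ φ⁻¹ dy` for `F` supported in the chart domain.
3. *The Laplacian in the chart* (`ChartLaplacian.lean`: Koszul formula on coordinate fields,
   `hessian_apply`, metric trace in the coordinate basis):
   `Δ_h f ∘ φ⁻¹ = hⁱʲ(∂ᵢ∂ⱼ f̂ − Γˡᵢⱼ ∂ₗ f̂)` with `f̂ = f ∘ φ⁻¹`, `h_{ij} = chartGramMatrix h x`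
   (`chartGramMatrix_apply_eq_val_localFrame`).
4. *Divergence form* (`Analysis/Calculus/CoordinateLaplacian.lean`, Jacobi's formula for
   `∂√det` and `∂(h⁻¹)` from `MatrixFieldDeriv.lean`): `√h Δ_h f ∘ φ⁻¹ = ∑ᵢ ∂ᵢ(√h hⁱˡ ∂ₗ f̂)`
   (Lee 2018, Prop. 2.46).
5. *Integration by parts on `ℝ^m`* (Mathlib's `integral_mul_fderiv_eq_neg_fderiv_mul_of_integrable`)
   against the zero extension `F` of `û = u ∘ φ⁻¹`, a compactly supported `C¹` function on `ℝ^m`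
   (`contDiff_of_contDiffOn_of_eq_zero`): `∫ F ∑ᵢ ∂ᵢWᵢ = −∫ ∑ᵢ ∂ᵢF Wᵢ`, `Wᵢ = √h hⁱˡ ∂ₗ f̂`.
6. *Back to the manifold*: `∑ᵢ ∂ᵢF Wᵢ = √h · h⁻¹(du, df) ∘ φ⁻¹`
   (`innerDual_mvfderiv_eq_sum_localFrame`) and step 2 again.

Everything is proved; there are no definitions and no named facts. Hypotheses throughout:
`[CompactSpace N] [T2Space N] [MeasurableSpace N] [BorelSpace N]` (as for `hawkingMass`), the
metric `h` smooth (`C^∞`), `[(ofRiemannian h).HasLeviCivita]` (always available,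
`PseudoRiemannianMetric.hasLeviCivita`). For surfaces, `riemannianMeasure h = riemannianVolume h 2`
(`riemannianMeasure_eq_riemannianVolume`), the area measure of `hawkingMass`.

## References

* J. M. Lee, *Introduction to Riemannian Manifolds*, 2nd ed., GTM 176, Springer 2018,
  Problem 2-23 (Green's identities; (c) `∫_M Δu dV_g = 0` for `∂M = ∅`), Prop. 2.46 (divergence
  and Laplacian in coordinates) (key `Lee2018`).
* G. Huisken, T. Ilmanen, *The inverse mean curvature flow and the Riemannian Penrose
  inequality*, J. Differential Geom. 59 (2001), §5, Monotonicity Calculation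
  (`∫ −2HΔ(H⁻¹) = −2∫|DH|²/H²`) (key `HuiskenIlmanenIMCF2001`).
* H. Federer, *Geometric Measure Theory* (1969), §3.2.46 (Riemannian measure = Hausdorff measure;
  through `VolumeChartFormula.lean`).
-/

noncomputable section

open Bundle Set Function Filter Manifold MeasureTheory Finset
open scoped Manifold ContDiff Topology Matrix ENNReal

namespace Literature.Geometry.Lorentzian

open PseudoRiemannianMetric

/-! ### Functions localized in an open set of a normed space -/

section Localized

variable {E : Type*} [NormedAddCommGroup E] [NormedSpace ℝ E] {T K : Set E} {F : E → ℝ}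

/-- A function which is `C^n` on an open set `T` and vanishes off a compact subset `K ⊆ T` is `C^n`
on the whole space (it vanishes on the open set `Kᶜ`). [folklore] -/
theorem contDiff_of_contDiffOn_of_eq_zero (hT : IsOpen T) (hK : IsCompact K) (hKT : K ⊆ T)
    {n : ℕ∞} (hF : ContDiffOn ℝ n F T) (hF0 : ∀ y ∉ K, F y = 0) : ContDiff ℝ n F := by
  rw [contDiff_iff_contDiffAt]
  intro y
  by_cases hy : y ∈ T
  · exact hF.contDiffAt (hT.mem_nhds hy)
  · have hyK : y ∉ K := fun h' ↦ hy (hKT h')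
    have hev : F =ᶠ[𝓝 y] fun _ ↦ 0 := by
      filter_upwards [hK.isClosed.isOpen_compl.mem_nhds hyK] with z hz
      exact hF0 z hz
    exact contDiffAt_const.congr_of_eventuallyEq hev

/-- The derivative of a function vanishing off a compact (closed) set vanishes off that set.
[folklore] -/
theorem fderiv_eq_zero_of_eq_zero (hK : IsCompact K) (hF0 : ∀ y ∉ K, F y = 0) {y : E}
    (hy : y ∉ K) : fderiv ℝ F y = 0 := by
  have hev : F =ᶠ[𝓝 y] fun _ ↦ 0 := by
    filter_upwards [hK.isClosed.isOpen_compl.mem_nhds hy] with z hz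
    exact hF0 z hz
  rw [hev.fderiv_eq]
  exact fderiv_const_apply 0

omit [NormedSpace ℝ E] in
/-- **Products of a localized function with a function continuous on `T` are continuous**: if `F`
is continuous, vanishes off a compact `K ⊆ T` (`T` open) and `X` is continuous on `T`, then
`F · X` is continuous on the whole space. [folklore] -/
theorem continuous_mul_of_eq_zero (hT : IsOpen T) (hK : IsCompact K) (hKT : K ⊆ T)
    (hFc : Continuous F) (hF0 : ∀ y ∉ K, F y = 0) {X : E → ℝ} (hX : ContinuousOn X T) :
    Continuous (fun y ↦ F y * X y) := by
  rw [continuous_iff_continuousAt]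
  intro y
  by_cases hy : y ∈ T
  · exact hFc.continuousAt.mul (hX.continuousAt (hT.mem_nhds hy))
  · have hyK : y ∉ K := fun h' ↦ hy (hKT h')
    have hev : (fun y ↦ F y * X y) =ᶠ[𝓝 y] fun _ ↦ 0 := by
      filter_upwards [hK.isClosed.isOpen_compl.mem_nhds hyK] with z hz
      simp [hF0 z hz]
    exact continuousAt_const.congr hev.symm

omit [NormedSpace ℝ E] in
/-- Products with a function vanishing off a compact set have compact support. [folklore] -/
theorem hasCompactSupport_mul_of_eq_zero (hK : IsCompact K) (hF0 : ∀ y ∉ K, F y = 0)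
    (X : E → ℝ) : HasCompactSupport (fun y ↦ F y * X y) :=
  HasCompactSupport.intro hK (fun y hy ↦ by simp [hF0 y hy])

end Localized

/-! ### Manifold-side preliminaries -/

section Manifold

variable {E : Type*} [NormedAddCommGroup E] [NormedSpace ℝ E] {H : Type*} [TopologicalSpace H]
  {I : ModelWithCorners ℝ E H} {M : Type*} [TopologicalSpace M] [ChartedSpace H M]

/-- **Differentials of finite sums**: `d(∑ᵢ Fᵢ)_p = ∑ᵢ d(Fᵢ)_p` for functions differentiable at
`p` (Mathlib's `mvfderiv_add`, by induction). [folklore] -/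
theorem mvfderiv_finset_sum {ι : Type*} (s : Finset ι) {F : ι → M → ℝ} {p : M}
    (hF : ∀ i ∈ s, MDifferentiableAt I 𝓘(ℝ, ℝ) (F i) p) :
    MDifferentiableAt I 𝓘(ℝ, ℝ) (fun x ↦ ∑ i ∈ s, F i x) p ∧
      mvfderiv I (fun x ↦ ∑ i ∈ s, F i x) p = ∑ i ∈ s, mvfderiv I (F i) p := by
  classical
  induction s using Finset.induction_on with
  | empty =>
    simp only [Finset.sum_empty]
    exact ⟨mdifferentiableAt_const, mvfderiv_const (I := I) (0 : ℝ)⟩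
  | insert a s ha ih =>
    have hFa : MDifferentiableAt I 𝓘(ℝ, ℝ) (F a) p := hF a (Finset.mem_insert_self a s)
    obtain ⟨hd, heq⟩ := ih (fun i hi ↦ hF i (Finset.mem_insert_of_mem hi))
    have hfun : (fun x ↦ ∑ i ∈ insert a s, F i x) = fun x ↦ F a x + ∑ i ∈ s, F i x := by
      funext x
      rw [Finset.sum_insert ha]
    rw [hfun, Finset.sum_insert ha]
    exact ⟨hFa.add hd, by rw [mvfderiv_fun_add hFa hd, heq]⟩

/-- The differential of a function vanishes outside its topological support. [folklore] -/
theorem mvfderiv_eq_zero_of_notMem_tsupport {w : M → ℝ} {p : M} (hp : p ∉ tsupport w) :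
    mvfderiv I w p = 0 := by
  have hev : w =ᶠ[𝓝 p] fun _ ↦ 0 := by
    filter_upwards [(isClosed_tsupport w).isOpen_compl.mem_nhds hp] with z hz
    exact image_eq_zero_of_notMem_tsupport hz
  have h0 : mfderiv I 𝓘(ℝ, ℝ) w p = 0 := by
    rw [hev.mfderiv_eq]
    exact mfderiv_const
  ext v
  simp [mvfderiv, h0]

end Manifold

/-! ### The metric coefficients of `Volume.lean` are the Gram matrix of the coordinate frame -/

section ChartGram

variable {m : ℕ} {H : Type*} [TopologicalSpace H] {n : ℕ∞ω}
  {I : ModelWithCorners ℝ (EuclideanSpace ℝ (Fin m)) H}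
  {N : Type*} [TopologicalSpace N] [ChartedSpace H N] [IsManifold I ∞ N]
  (h : ContMDiffRiemannianMetric I n (EuclideanSpace ℝ (Fin m)) (TangentSpace I : N → Type _))
  (x : N)

/-- **`chartGramMatrix` is the Gram matrix of the coordinate frame**: for `y` in the chart
target, `chartGramMatrix h x y i j = h(∂ᵢ, ∂ⱼ)(φ⁻¹ y)` with `∂ᵢ` the local frame of `TN` induced
by the trivialization at `x` and the standard basis of `ℝ^m` (both are `D(φ⁻¹)(y) eᵢ`,
`localFrame_apply_eq_mfderivWithin_symm`). [folklore] -/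
theorem chartGramMatrix_apply_eq_val_localFrame {y : EuclideanSpace ℝ (Fin m)}
    (hy : y ∈ (extChartAt I x).target) (i j : Fin m) :
    chartGramMatrix h x y i j = (ofRiemannian h).val ((extChartAt I x).symm y)
      ((trivializationAt (EuclideanSpace ℝ (Fin m)) (TangentSpace I) x).localFrame
        (EuclideanSpace.basisFun (Fin m) ℝ).toBasis i ((extChartAt I x).symm y))
      ((trivializationAt (EuclideanSpace ℝ (Fin m)) (TangentSpace I) x).localFrame
        (EuclideanSpace.basisFun (Fin m) ℝ).toBasis j ((extChartAt I x).symm y)) := by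
  have hys : (extChartAt I x).symm y ∈ (chartAt H x).source := by
    rw [← extChartAt_source I]; exact (extChartAt I x).map_target hy
  rw [localFrame_apply_eq_mfderivWithin_symm _ hys, localFrame_apply_eq_mfderivWithin_symm _ hys,
    (extChartAt I x).right_inv hy]
  simp only [chartGramMatrix, Matrix.of_apply, val_ofRiemannian, OrthonormalBasis.coe_toBasis,
    EuclideanSpace.basisFun_apply]

/-- `chartGramMatrix` is symmetric (everywhere, including off the chart target). [folklore] -/
theorem chartGramMatrix_apply_comm (y : EuclideanSpace ℝ (Fin m)) (i j : Fin m) :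
    chartGramMatrix h x y i j = chartGramMatrix h x y j i := by
  simp only [chartGramMatrix, Matrix.of_apply]
  exact h.symm _ _ _

variable [T3Space N] [MeasurableSpace N] [BorelSpace N]

/-- The Riemannian measure of a compact manifold is finite
(`riemannianVolume_lt_top_of_isCompact_holds`). [folklore] -/
theorem isFiniteMeasure_riemannianMeasure [CompactSpace N] : IsFiniteMeasure (riemannianMeasure h) :=
  ⟨riemannianVolume_lt_top_of_isCompact_holds h le_rfl isCompact_univ⟩

end ChartGram

/-! ### Green's identity for a function supported in one chart -/

section Core

variable {m : ℕ} {H : Type*} [TopologicalSpace H]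
  {I : ModelWithCorners ℝ (EuclideanSpace ℝ (Fin m)) H} [I.Boundaryless]
  {N : Type*} [TopologicalSpace N] [ChartedSpace H N] [IsManifold I ∞ N] [CompactSpace N]
  [T2Space N] [MeasurableSpace N] [BorelSpace N]
  (h : ContMDiffRiemannianMetric I ∞ (EuclideanSpace ℝ (Fin m)) (TangentSpace I : N → Type _))
  [(ofRiemannian h).HasLeviCivita]

/-- **Green's first identity for a function supported in a chart domain.** On a compact
Riemannian manifold `(N, h)` modelled on `ℝ^m` (boundaryless), for `w ∈ C¹(N)` with
`tsupport w` inside the chart domain of `x` and `f ∈ C²(N)`: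
`∫_N w Δ_h f dμ_h = −∫_N h⁻¹(dw, df) dμ_h`. Proof: by the chart formula for the measure
(`integral_eq_integral_chart`) the left side is `∫_{φ.target} ŵ √g Δf̂ dy`; by the coordinate
formula for `Δ` (`dalembertian_eq_sum_localFrame`) and its divergence form
(`coordLaplacian_mul_sqrt_det_eq_sum_fderiv`) this is `∫ F ∑ᵢ ∂ᵢ(√g gⁱˡ ∂ₗ f̂) dy` with
`F = ŵ` extended by zero (a compactly supported `C¹` function on `ℝ^m`); integrating by parts on
`ℝ^m` (Mathlib's `integral_mul_fderiv_eq_neg_fderiv_mul_of_integrable`) gives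
`−∫ √g gⁱˡ ∂ᵢF ∂ₗ f̂ dy = −∫_{φ.target} √g · h⁻¹(dw, df) ∘ φ⁻¹ dy`
(`innerDual_mvfderiv_eq_sum_localFrame`), which is the right side by the chart formula again.
Lee 2018, Problem 2-23 (a) (Green's identities, `∂M = ∅`), proof via Prop. 2.46.
[cite: Lee2018, Problem 2-23 (a) and Prop. 2.46] -/
theorem integral_mul_dalembertian_of_tsupport_subset (x : N) {w f : N → ℝ} (hw : CMDiff 1 w)
    (hf : CMDiff 2 f) (hsupp : tsupport w ⊆ (chartAt H x).source) :
    ∫ p, w p * (ofRiemannian h).dalembertian f p ∂riemannianMeasure h =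
      -∫ p, (ofRiemannian h).innerDual p (mvfderiv I w p).toLinearMap (mvfderiv I f p).toLinearMap
        ∂riemannianMeasure h := by
  classical
  -- notation: the model space, its standard basis, the chart and its target
  set b : Module.Basis (Fin m) ℝ (EuclideanSpace ℝ (Fin m)) := (EuclideanSpace.basisFun (Fin m) ℝ).toBasis
    with hb_def
  have hb : ∀ i, b i = EuclideanSpace.single i 1 := fun i ↦ by
    simp [hb_def]
  obtain ⟨φ, hφ⟩ : ∃ φ : PartialEquiv N (EuclideanSpace ℝ (Fin m)), φ = extChartAt I x := ⟨_, rfl⟩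
  obtain ⟨T, hTdef⟩ : ∃ T : Set (EuclideanSpace ℝ (Fin m)), T = (extChartAt I x).target := ⟨_, rfl⟩
  have hT : IsOpen T := by rw [hTdef]; exact isOpen_extChartAt_target x
  have hTm : MeasurableSet T := hT.measurableSet
  have hsrc : (chartAt H x).source = (extChartAt I x).source :=
    (extChartAt_source (I := I) (x := x)).symm
  have hsuppS : tsupport w ⊆ (extChartAt I x).source := hsrc ▸ hsupp
  -- the compact set `K = φ (tsupport w) ⊆ T`
  obtain ⟨K, hKdef⟩ : ∃ K : Set (EuclideanSpace ℝ (Fin m)), K = extChartAt I x '' tsupport w :=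
    ⟨_, rfl⟩
  have hKc : IsCompact K := by
    rw [hKdef]
    exact ((isClosed_tsupport w).isCompact).image_of_continuousOn
      ((continuousOn_extChartAt x).mono hsuppS)
  have hKT : K ⊆ T := by
    rw [hKdef, hTdef]
    rintro _ ⟨p, hp, rfl⟩
    exact (extChartAt I x).map_source (hsuppS hp)
  -- the chart representatives
  obtain ⟨Gh, hGh⟩ : ∃ Gh : EuclideanSpace ℝ (Fin m) → Fin m → Fin m → ℝ,
      Gh = fun y i j ↦ chartGramMatrix h x y i j := ⟨_, rfl⟩
  have hofG : ∀ y, Matrix.of (Gh y) = chartGramMatrix h x y := fun y ↦ by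
    rw [hGh]; rfl
  obtain ⟨fh, hfh⟩ : ∃ fh : EuclideanSpace ℝ (Fin m) → ℝ, fh = f ∘ (extChartAt I x).symm := ⟨_, rfl⟩
  obtain ⟨F, hF⟩ : ∃ F : EuclideanSpace ℝ (Fin m) → ℝ, F = T.indicator (w ∘ (extChartAt I x).symm) :=
    ⟨_, rfl⟩
  obtain ⟨W, hW⟩ : ∃ W : Fin m → EuclideanSpace ℝ (Fin m) → ℝ, W = fun i y ↦
      Real.sqrt (Matrix.of (Gh y)).det * ∑ l, (Matrix.of (Gh y))⁻¹ i l * fderiv ℝ fh y (b l) :=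
    ⟨_, rfl⟩
  -- `F` vanishes off `K` and agrees with `ŵ` on `T`
  have hFT : ∀ y ∈ T, F y = w ((extChartAt I x).symm y) := fun y hy ↦ by
    rw [hF, indicator_of_mem hy]; rfl
  have hF0 : ∀ y ∉ K, F y = 0 := by
    intro y hyK
    by_cases hyT : y ∈ T
    · rw [hFT y hyT]
      refine image_eq_zero_of_notMem_tsupport (fun hmem ↦ hyK ?_)
      rw [hKdef]
      refine ⟨_, hmem, (extChartAt I x).right_inv ?_⟩
      rwa [hTdef] at hyT
    · rw [hF, indicator_of_notMem hyT]
  have hsuppF : tsupport F ⊆ K :=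
    closure_minimal (fun y hy ↦ by_contra fun hyK ↦ hy (hF0 y hyK)) hKc.isClosed
  -- regularity of the representatives on `T`
  have hŵ1 : ContDiffOn ℝ 1 (w ∘ (extChartAt I x).symm) T := by
    rw [hTdef]; exact contDiffOn_comp_extChartAt_symm hw
  have hF1 : ContDiff ℝ 1 F :=
    contDiff_of_contDiffOn_of_eq_zero hT hKc hKT (hŵ1.congr fun y hy ↦ hFT y hy) hF0
  have hfh2 : ContDiffOn ℝ 2 fh T := by
    rw [hfh, hTdef]; exact contDiffOn_comp_extChartAt_symm hf
  have hGT : ∀ y ∈ T, ∀ i j, Gh y i j = (ofRiemannian h).val ((extChartAt I x).symm y)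
      ((trivializationAt (EuclideanSpace ℝ (Fin m)) (TangentSpace I) x).localFrame b i
        ((extChartAt I x).symm y))
      ((trivializationAt (EuclideanSpace ℝ (Fin m)) (TangentSpace I) x).localFrame b j
        ((extChartAt I x).symm y)) := by
    intro y hy i j
    rw [hGh]
    exact chartGramMatrix_apply_eq_val_localFrame h x (hTdef ▸ hy) i j
  have hGsm : ∀ i j, ContDiffOn ℝ ∞ (fun y ↦ Gh y i j) T := fun i j ↦ by
    rw [hTdef]
    exact (contDiffOn_gram_comp_extChartAt_symm b (ofRiemannian h) i j).congr
      (fun y hy ↦ hGT y (hTdef ▸ hy) i j)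
  have hGpi : ContDiffOn ℝ ∞ Gh T :=
    contDiffOn_pi.2 fun i ↦ contDiffOn_pi.2 fun j ↦ hGsm i j
  have hGsym : ∀ z i j, Gh z i j = Gh z j i := fun z i j ↦ by
    rw [hGh]; exact chartGramMatrix_apply_comm h x z i j
  have hdetpos : ∀ y ∈ T, 0 < (Matrix.of (Gh y)).det := fun y hy ↦ by
    rw [hofG]
    exact Real.sqrt_pos.1 (sqrt_det_chartGramMatrix_pos h x (hTdef ▸ hy))
  have hGdet : ContDiffOn ℝ ∞ (fun y ↦ (Matrix.of (Gh y)).det) T := by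
    intro y hy
    have h1 := contMDiffAt_matrix_det (I := 𝓘(ℝ, EuclideanSpace ℝ (Fin m))) (k := ∞)
      (A := fun y ↦ Matrix.of (Gh y)) (x₀ := y)
      (fun i j ↦ contMDiffAt_iff_contDiffAt.2 ((hGsm i j).contDiffAt (hT.mem_nhds hy)))
    exact (contMDiffAt_iff_contDiffAt.1 h1).contDiffWithinAt
  have hρ : ContDiffOn ℝ ∞ (fun y ↦ Real.sqrt (Matrix.of (Gh y)).det) T :=
    hGdet.sqrt fun y hy ↦ (hdetpos y hy).ne'
  have hGinv : ∀ i l, ContDiffOn ℝ ∞ (fun y ↦ (Matrix.of (Gh y))⁻¹ i l) T := by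
    intro i l y hy
    have h1 := contMDiffAt_matrix_inv (I := 𝓘(ℝ, EuclideanSpace ℝ (Fin m))) (k := ∞)
      (A := fun y ↦ Matrix.of (Gh y)) (x₀ := y)
      (fun i j ↦ contMDiffAt_iff_contDiffAt.2 ((hGsm i j).contDiffAt (hT.mem_nhds hy)))
      (hdetpos y hy).ne' i l
    exact (contMDiffAt_iff_contDiffAt.1 h1).contDiffWithinAt
  have hdfh : ∀ l, ContDiffOn ℝ 1 (fun y ↦ fderiv ℝ fh y (b l)) T := fun l ↦
    (hfh2.fderiv_of_isOpen hT (by norm_num)).clm_apply contDiffOn_const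
  have hW1 : ∀ i, ContDiffOn ℝ 1 (W i) T := by
    intro i
    rw [hW]
    exact (hρ.of_le (by simp)).mul (ContDiffOn.sum fun l _ ↦ ((hGinv i l).of_le (by simp)).mul (hdfh l))
  have hWc : ∀ i, ContinuousOn (W i) T := fun i ↦ (hW1 i).continuousOn
  have hWd : ∀ i, ∀ y ∈ T, DifferentiableAt ℝ (W i) y := fun i y hy ↦
    ((hW1 i).contDiffAt (hT.mem_nhds hy)).differentiableAt one_ne_zero
  have hdWc : ∀ i (v : EuclideanSpace ℝ (Fin m)), ContinuousOn (fun y ↦ fderiv ℝ (W i) y v) T :=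
    fun i v ↦ ((hW1 i).continuousOn_fderiv_of_isOpen hT le_rfl).clm_apply continuousOn_const
  have hFc : Continuous F := hF1.continuous
  have hFd : Differentiable ℝ F := hF1.differentiable one_ne_zero
  have hdFc : ∀ v : EuclideanSpace ℝ (Fin m), Continuous (fun y ↦ fderiv ℝ F y v) := fun v ↦
    (hF1.continuous_fderiv one_ne_zero).clm_apply continuous_const
  have hdF0 : ∀ (v : EuclideanSpace ℝ (Fin m)), ∀ y ∉ K, fderiv ℝ F y v = 0 := fun v y hy ↦ by
    rw [fderiv_eq_zero_of_eq_zero hKc hF0 hy]; rfl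
  -- points of `T` correspond to points of the chart domain
  have hmemS : ∀ y ∈ T, (extChartAt I x).symm y ∈ (chartAt H x).source := fun y hy ↦ by
    rw [hsrc]; exact (extChartAt I x).map_target (hTdef ▸ hy)
  have hright : ∀ y ∈ T, extChartAt I x ((extChartAt I x).symm y) = y := fun y hy ↦
    (extChartAt I x).right_inv (hTdef ▸ hy)
  have hTnhds : ∀ y ∈ T, T ∈ 𝓝 y := fun y hy ↦ hT.mem_nhds hy
  -- (1) the Laplacian in the chart, in divergence form: `√g Δf ∘ φ⁻¹ = ∑ᵢ ∂ᵢ Wᵢ` on `T`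
  have hΔ : ∀ y ∈ T, Real.sqrt (Matrix.of (Gh y)).det *
      (ofRiemannian h).dalembertian f ((extChartAt I x).symm y) = ∑ i, fderiv ℝ (W i) y (b i) := by
    intro y hy
    have hGy : HasFDerivAt Gh (fderiv ℝ Gh y) y :=
      ((hGpi.contDiffAt (hTnhds y hy)).differentiableAt (by simp)).hasFDerivAt
    have hf2y : HasFDerivAt (fun z ↦ fderiv ℝ fh z) (fderiv ℝ (fderiv ℝ fh) y) y :=
      (((hfh2.fderiv_of_isOpen (m := 1) hT (by norm_num)).contDiffAt (hTnhds y hy)).differentiableAt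
        one_ne_zero).hasFDerivAt
    -- the coordinate formula for `Δ`
    have hL := dalembertian_eq_sum_localFrame (ofRiemannian h) b (hmemS y hy)
      (hf ((extChartAt I x).symm y)) (Gh := Gh) (fh := fh) (by
        rw [hright y hy]
        filter_upwards [hTnhds y hy] with z hz
        exact hGT z hz) (by rw [hright y hy, hfh])
    rw [hright y hy] at hL
    -- the divergence form
    have hC := Literature.Analysis.Calculus.coordLaplacian_mul_sqrt_det_eq_sum_fderiv b hGy hGsym
      (hdetpos y hy) hf2y
    rw [hL]
    simp only [Literature.Analysis.Calculus.fderiv_apply_apply_eq hGy] at hC ⊢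
    rw [hC, hW]
  -- (2) the integrand `∑ᵢ ∂ᵢF · Wᵢ` is `√g · h⁻¹(dw, df) ∘ φ⁻¹` on `T`
  have hIpt : ∀ y ∈ T, ∑ i, fderiv ℝ F y (b i) * W i y = Real.sqrt (Matrix.of (Gh y)).det *
      (ofRiemannian h).innerDual ((extChartAt I x).symm y)
        (mvfderiv I w ((extChartAt I x).symm y)).toLinearMap
        (mvfderiv I f ((extChartAt I x).symm y)).toLinearMap := by
    intro y hy
    have hIy := innerDual_mvfderiv_eq_sum_localFrame (ofRiemannian h) b (hmemS y hy)
      ((hw _).mdifferentiableAt one_ne_zero) ((hf _).mdifferentiableAt (by simp))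
      (uh := F) (vh := fh) (by
        rw [hright y hy]
        filter_upwards [hTnhds y hy] with z hz
        exact hFT z hz) (by rw [hright y hy, hfh])
    rw [hright y hy] at hIy
    have hmat : (Matrix.of fun i j ↦ (ofRiemannian h).val ((extChartAt I x).symm y)
        ((trivializationAt (EuclideanSpace ℝ (Fin m)) (TangentSpace I) x).localFrame b i
          ((extChartAt I x).symm y))
        ((trivializationAt (EuclideanSpace ℝ (Fin m)) (TangentSpace I) x).localFrame b j
          ((extChartAt I x).symm y))) = Matrix.of (Gh y) := by
      ext i j
      simp only [Matrix.of_apply, hGT y hy]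
    rw [hmat] at hIy
    rw [hIy, hW, Finset.mul_sum]
    simp only [Finset.mul_sum]
    refine Finset.sum_congr rfl (fun i _ ↦ Finset.sum_congr rfl (fun l _ ↦ ?_))
    ring
  -- (3) integrability on `ℝ^m` of the three products entering the integration by parts
  have hint1 : ∀ i, Integrable (fun y ↦ fderiv ℝ F y (b i) * W i y) := fun i ↦
    (continuous_mul_of_eq_zero hT hKc hKT (hdFc (b i)) (hdF0 (b i)) (hWc i)).integrable_of_hasCompactSupport
      (hasCompactSupport_mul_of_eq_zero hKc (hdF0 (b i)) (W i))
  have hint2 : ∀ i, Integrable (fun y ↦ F y * fderiv ℝ (W i) y (b i)) := fun i ↦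
    (continuous_mul_of_eq_zero hT hKc hKT hFc hF0 (hdWc i (b i))).integrable_of_hasCompactSupport
      (hasCompactSupport_mul_of_eq_zero hKc hF0 _)
  have hint3 : ∀ i, Integrable (fun y ↦ F y * W i y) := fun i ↦
    (continuous_mul_of_eq_zero hT hKc hKT hFc hF0 (hWc i)).integrable_of_hasCompactSupport
      (hasCompactSupport_mul_of_eq_zero hKc hF0 _)
  -- (4) integration by parts on `ℝ^m`
  have hIBP : ∀ i, ∫ y, F y * fderiv ℝ (W i) y (b i) = -∫ y, fderiv ℝ F y (b i) * W i y := fun i ↦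
    integral_mul_fderiv_eq_neg_fderiv_mul_of_integrable (hint1 i) (hint2 i) (hint3 i)
      (fun y _ ↦ hFd y) (fun y hy ↦ hWd i y (hKT (hsuppF hy)))
  -- (5) the left-hand side in the chart
  haveI := isFiniteMeasure_riemannianMeasure h
  have hΔc : Continuous ((ofRiemannian h).dalembertian f) := continuous_dalembertian _ hf
  have hLHS : ∫ p, w p * (ofRiemannian h).dalembertian f p ∂riemannianMeasure h =
      ∫ y in T, F y * ∑ i, fderiv ℝ (W i) y (b i) := by
    have hmeas : Measurable (fun p ↦ w p * (ofRiemannian h).dalembertian f p) :=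
      (hw.continuous.mul hΔc).measurable
    have hsup : support (fun p ↦ w p * (ofRiemannian h).dalembertian f p) ⊆
        (extChartAt I x).source := by
      intro p hp
      rw [mem_support] at hp
      exact hsuppS (subset_tsupport _ (left_ne_zero_of_mul hp))
    rw [integral_eq_integral_chart h x hmeas hsup, ← hTdef]
    refine setIntegral_congr_fun hTm (fun y hy ↦ ?_)
    simp only [smul_eq_mul]
    rw [← hofG, hFT y hy, ← hΔ y hy]
    ring
  -- (6) the right-hand side in the chart
  have hIc : Continuous (fun p ↦ (ofRiemannian h).innerDual p (mvfderiv I w p).toLinearMap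
      (mvfderiv I f p).toLinearMap) :=
    continuous_innerDual_mvfderiv _ hw (hf.of_le (by norm_num))
  have hRHS : ∫ p, (ofRiemannian h).innerDual p (mvfderiv I w p).toLinearMap
      (mvfderiv I f p).toLinearMap ∂riemannianMeasure h =
      ∫ y in T, ∑ i, fderiv ℝ F y (b i) * W i y := by
    have hsup : support (fun p ↦ (ofRiemannian h).innerDual p (mvfderiv I w p).toLinearMap
        (mvfderiv I f p).toLinearMap) ⊆ (extChartAt I x).source := by
      intro p hp
      rw [mem_support] at hp
      refine hsuppS (by_contra fun hnot ↦ hp ?_)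
      rw [mvfderiv_eq_zero_of_notMem_tsupport hnot]
      simp [PseudoRiemannianMetric.innerDual]
    rw [integral_eq_integral_chart h x hIc.measurable hsup, ← hTdef]
    refine setIntegral_congr_fun hTm (fun y hy ↦ ?_)
    rw [smul_eq_mul, ← hofG, hIpt y hy]
  -- (7) assemble
  rw [hLHS, hRHS]
  have hint2' : ∀ i, IntegrableOn (fun y ↦ F y * fderiv ℝ (W i) y (b i)) T := fun i ↦
    (hint2 i).integrableOn
  calc ∫ y in T, F y * ∑ i, fderiv ℝ (W i) y (b i)
      = ∫ y in T, ∑ i, F y * fderiv ℝ (W i) y (b i) := by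
        simp only [Finset.mul_sum]
    _ = ∑ i, ∫ y in T, F y * fderiv ℝ (W i) y (b i) := integral_finsetSum _ (fun i _ ↦ hint2' i)
    _ = ∑ i, ∫ y, F y * fderiv ℝ (W i) y (b i) := by
        refine Finset.sum_congr rfl (fun i _ ↦ ?_)
        refine setIntegral_eq_integral_of_forall_compl_eq_zero (fun y hy ↦ ?_)
        rw [hF0 y (fun hK ↦ hy (hKT hK)), zero_mul]
    _ = ∑ i, -∫ y, fderiv ℝ F y (b i) * W i y := Finset.sum_congr rfl (fun i _ ↦ hIBP i)
    _ = -∫ y, ∑ i, fderiv ℝ F y (b i) * W i y := by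
        rw [Finset.sum_neg_distrib, integral_finsetSum _ (fun i _ ↦ hint1 i)]
    _ = -∫ y in T, ∑ i, fderiv ℝ F y (b i) * W i y := by
        congr 1
        refine (setIntegral_eq_integral_of_forall_compl_eq_zero (fun y hy ↦ ?_)).symm
        exact Finset.sum_eq_zero (fun i _ ↦ by
          rw [hdF0 (b i) y (fun hK ↦ hy (hKT hK)), zero_mul])

omit [I.Boundaryless] [(ofRiemannian h).HasLeviCivita] in
/-- Continuous functions on the compact manifold are integrable for the (finite) Riemannian
measure. [folklore] -/
theorem integrable_of_continuous {F : N → ℝ} (hF : Continuous F) : Integrable F (riemannianMeasure h) := by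
  haveI := isFiniteMeasure_riemannianMeasure h
  simpa [integrableOn_univ] using hF.continuousOn.integrableOn_compact isCompact_univ

/-- **Green's first identity on a closed Riemannian manifold.** For a compact Riemannian
manifold `(N, h)` without boundary (modelled on `ℝ^m`, boundaryless model), `u ∈ C¹(N)` and
`f ∈ C²(N)`:
`∫_N u Δ_h f dμ_h = −∫_N h⁻¹(du, df) dμ_h = −∫_N ⟨grad u, grad f⟩ dμ_h`, where `Δ_h = tr_h Hess`
is the Laplace–Beltrami operator (`dalembertian`), `h⁻¹` the inverse metric on covectors
(`innerDual`) and `μ_h` the Riemannian measure (`riemannianMeasure`, the `m`-dimensional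
Hausdorff measure of the length metric). Proof: a finite smooth partition of unity subordinate to
chart domains (Mathlib's `SmoothPartitionOfUnity.exists_isSubordinate` on a finite subcover)
reduces to `integral_mul_dalembertian_of_tsupport_subset`, by linearity of `u ↦ ∫ u Δf` and of
`u ↦ du` (`mvfderiv_finset_sum`). Lee 2018, Problem 2-23 (a) (Green's identities; here
`∂M = ∅`). [cite: Lee2018, Problem 2-23 (a)] -/
theorem integral_mul_dalembertian_eq_neg_integral_innerDual {u f : N → ℝ} (hu : CMDiff 1 u)
    (hf : CMDiff 2 f) :
    ∫ p, u p * (ofRiemannian h).dalembertian f p ∂riemannianMeasure h =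
      -∫ p, (ofRiemannian h).innerDual p (mvfderiv I u p).toLinearMap (mvfderiv I f p).toLinearMap
        ∂riemannianMeasure h := by
  classical
  -- a finite subcover of `N` by chart domains and a smooth partition of unity subordinate to it
  obtain ⟨t, ht⟩ := CompactSpace.elim_nhds_subcover (fun x : N ↦ (chartAt H x).source)
    (fun x ↦ (chartAt H x).open_source.mem_nhds (mem_chart_source H x))
  obtain ⟨ρ, hρ⟩ := SmoothPartitionOfUnity.exists_isSubordinate I isClosed_univ
    (fun i : t ↦ (chartAt H (i : N)).source) (fun i ↦ (chartAt H (i : N)).open_source) (by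
      intro p _
      have hp : p ∈ ⋃ x ∈ t, (chartAt H x).source := by rw [ht]; trivial
      simp only [mem_iUnion] at hp ⊢
      obtain ⟨x, hx, hpx⟩ := hp
      exact ⟨⟨x, hx⟩, hpx⟩)
  have hsum : ∀ p, ∑ i, ρ i p = 1 := fun p ↦ by
    rw [← finsum_eq_sum_of_fintype]
    exact ρ.sum_eq_one (mem_univ p)
  have hρ1 : ∀ i, CMDiff 1 (ρ i) := fun i ↦ (ρ i).contMDiff.of_le (by exact_mod_cast le_top)
  have hw : ∀ i, CMDiff 1 (fun p ↦ ρ i p * u p) := fun i ↦ (hρ1 i).mul hu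
  have hwsupp : ∀ i, tsupport (fun p ↦ ρ i p * u p) ⊆ (chartAt H (i : N)).source := fun i ↦
    (tsupport_mul_subset_left).trans (hρ i)
  -- Green's identity for each piece `ρᵢ u`
  have hpiece : ∀ i, ∫ p, (ρ i p * u p) * (ofRiemannian h).dalembertian f p ∂riemannianMeasure h =
      -∫ p, (ofRiemannian h).innerDual p (mvfderiv I (fun p ↦ ρ i p * u p) p).toLinearMap
        (mvfderiv I f p).toLinearMap ∂riemannianMeasure h :=
    fun i ↦ integral_mul_dalembertian_of_tsupport_subset h (i : N) (hw i) hf (hwsupp i)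
  -- continuity (hence integrability) of the integrands
  have hΔc : Continuous ((ofRiemannian h).dalembertian f) := continuous_dalembertian _ hf
  have hIc : ∀ i, Continuous (fun p ↦ (ofRiemannian h).innerDual p
      (mvfderiv I (fun p ↦ ρ i p * u p) p).toLinearMap (mvfderiv I f p).toLinearMap) :=
    fun i ↦ continuous_innerDual_mvfderiv _ (hw i) (hf.of_le (by norm_num))
  -- linearity on the left
  have hL : ∫ p, u p * (ofRiemannian h).dalembertian f p ∂riemannianMeasure h =
      ∑ i, ∫ p, (ρ i p * u p) * (ofRiemannian h).dalembertian f p ∂riemannianMeasure h := by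
    have heq : (fun p ↦ u p * (ofRiemannian h).dalembertian f p) =
        fun p ↦ ∑ i, (ρ i p * u p) * (ofRiemannian h).dalembertian f p := by
      funext p
      rw [← Finset.sum_mul, ← Finset.sum_mul, hsum p, one_mul]
    rw [heq]
    exact integral_finsetSum _ (fun i _ ↦ integrable_of_continuous h
      (show Continuous (fun p ↦ (ρ i p * u p) * (ofRiemannian h).dalembertian f p) from
        (hw i).continuous.mul hΔc))
  -- linearity on the right: `du = ∑ᵢ d(ρᵢ u)`
  have hdu : ∀ p, mvfderiv I u p = ∑ i, mvfderiv I (fun p ↦ ρ i p * u p) p := by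
    intro p
    have hu' : u = fun q ↦ ∑ i, ρ i q * u q := by
      funext q
      rw [← Finset.sum_mul, hsum q, one_mul]
    conv_lhs => rw [hu']
    exact (mvfderiv_finset_sum (I := I) Finset.univ (fun i _ ↦
      ((hw i) p).mdifferentiableAt one_ne_zero)).2
  have hR : ∫ p, (ofRiemannian h).innerDual p (mvfderiv I u p).toLinearMap
      (mvfderiv I f p).toLinearMap ∂riemannianMeasure h =
      ∑ i, ∫ p, (ofRiemannian h).innerDual p (mvfderiv I (fun p ↦ ρ i p * u p) p).toLinearMap
        (mvfderiv I f p).toLinearMap ∂riemannianMeasure h := by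
    have heq : (fun p ↦ (ofRiemannian h).innerDual p (mvfderiv I u p).toLinearMap
        (mvfderiv I f p).toLinearMap) =
        fun p ↦ ∑ i, (ofRiemannian h).innerDual p
          (mvfderiv I (fun p ↦ ρ i p * u p) p).toLinearMap (mvfderiv I f p).toLinearMap := by
      funext p
      simp only [PseudoRiemannianMetric.innerDual, hdu p, ContinuousLinearMap.coe_coe,
        FunLike.coe_sum, Finset.sum_apply]
    rw [heq]
    exact integral_finsetSum _ (fun i _ ↦ integrable_of_continuous h (hIc i))
  rw [hL, hR, ← Finset.sum_neg_distrib]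
  exact Finset.sum_congr rfl (fun i _ ↦ hpiece i)

/-- **The integral of the Laplacian over a closed manifold vanishes**: `∫_N Δ_h f dμ_h = 0` for
`f ∈ C²(N)` (Green's identity with `u = 1`, `du = 0`). Lee 2018, Problem 2-23 (c).
[cite: Lee2018, Problem 2-23 (c)] -/
theorem integral_dalembertian_eq_zero {f : N → ℝ} (hf : CMDiff 2 f) :
    ∫ p, (ofRiemannian h).dalembertian f p ∂riemannianMeasure h = 0 := by
  have h1 := integral_mul_dalembertian_eq_neg_integral_innerDual h (u := fun _ ↦ (1 : ℝ))
    contMDiff_const hf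
  simp only [one_mul] at h1
  rw [h1]
  have h0 : ∀ p, mvfderiv I (fun _ : N ↦ (1 : ℝ)) p = 0 := fun p ↦ mvfderiv_const (I := I) (1 : ℝ)
  simp [h0, PseudoRiemannianMetric.innerDual]

omit [I.Boundaryless] [CompactSpace N] [T2Space N] [MeasurableSpace N] [BorelSpace N]
  [(ofRiemannian h).HasLeviCivita] in
/-- The inverse metric of a Riemannian metric is positive semidefinite on covectors:
`h⁻¹(α, α) = h(♯α, ♯α) ≥ 0`. [folklore] -/
theorem innerDual_self_nonneg (p : N) (α : Module.Dual ℝ (TangentSpace I p)) :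
    0 ≤ (ofRiemannian h).innerDual p α α := by
  rw [PseudoRiemannianMetric.innerDual_eq_val_sharp_sharp]
  by_cases hv : (ofRiemannian h).sharp p α = 0
  · rw [hv]; simp
  · exact (isRiemannian_ofRiemannian h p _ hv).le

omit [I.Boundaryless] [IsManifold I ∞ N] [CompactSpace N] [T2Space N] [MeasurableSpace N]
  [BorelSpace N] in
/-- **The differential of `1/H`**: for `H` differentiable at `p` with `H p ≠ 0`,
`d(H⁻¹)_p = −(H p)⁻² dH_p` (from `d(H · H⁻¹) = 0` and Mathlib's `mvfderiv_mul`). [folklore] -/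
theorem mvfderiv_inv_eq {F : N → ℝ} {p : N} (hF : MDifferentiableAt I 𝓘(ℝ, ℝ) F p)
    (hFinv : MDifferentiableAt I 𝓘(ℝ, ℝ) (fun q ↦ (F q)⁻¹) p) (hne : ∀ q, F q ≠ 0) :
    mvfderiv I (fun q ↦ (F q)⁻¹) p = -((F p)⁻¹ * (F p)⁻¹) • mvfderiv I F p := by
  have hprod : (fun q ↦ F q * (F q)⁻¹) = fun _ ↦ (1 : ℝ) := by
    funext q; rw [mul_inv_cancel₀ (hne q)]
  have h1 : mvfderiv I (fun q ↦ F q * (F q)⁻¹) p = 0 := by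
    rw [hprod]; exact mvfderiv_const (I := I) (1 : ℝ)
  rw [mvfderiv_fun_mul hF hFinv] at h1
  -- `h1 : F p • d(F⁻¹) + (F p)⁻¹ • dF = 0`
  have h2 : (F p) • mvfderiv I (fun q ↦ (F q)⁻¹) p = -((F p)⁻¹ • mvfderiv I F p) :=
    eq_neg_of_add_eq_zero_left h1
  calc mvfderiv I (fun q ↦ (F q)⁻¹) p
      = (F p)⁻¹ • ((F p) • mvfderiv I (fun q ↦ (F q)⁻¹) p) := by
        rw [smul_smul, inv_mul_cancel₀ (hne p), one_smul]
    _ = -((F p)⁻¹ * (F p)⁻¹) • mvfderiv I F p := by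
        rw [h2, smul_neg, smul_smul, neg_smul]

/-- **`∫ H Δ(H⁻¹) = ∫ |dH|²/H² ≥ 0` on a closed Riemannian manifold**: for `H ∈ C²(N)` nowhere
zero, `∫_N H Δ_h(H⁻¹) dμ_h = ∫_N H⁻² h⁻¹(dH, dH) dμ_h` (Green's identity with `u = H`,
`f = H⁻¹`, `d(H⁻¹) = −H⁻² dH`). This is the integration by parts
`∫ −2HΔ(H⁻¹) = −2∫ |DH|²/H²` of Huisken–Ilmanen's Monotonicity Calculation (J. Differential
Geom. 59 (2001), §5). [cite: HuiskenIlmanenIMCF2001, §5 Monotonicity Calculation (integration by parts)] -/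
theorem integral_mul_dalembertian_inv_eq {F : N → ℝ} (hF : CMDiff 2 F) (hne : ∀ q, F q ≠ 0) :
    ∫ p, F p * (ofRiemannian h).dalembertian (fun q ↦ (F q)⁻¹) p ∂riemannianMeasure h =
      ∫ p, ((F p)⁻¹ * (F p)⁻¹) *
        (ofRiemannian h).innerDual p (mvfderiv I F p).toLinearMap (mvfderiv I F p).toLinearMap
        ∂riemannianMeasure h := by
  have hFinv : CMDiff 2 (fun q ↦ (F q)⁻¹) := hF.inv₀ hne
  rw [integral_mul_dalembertian_eq_neg_integral_innerDual h (hF.of_le (by norm_num)) hFinv,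
    ← integral_neg]
  refine integral_congr_ae (Eventually.of_forall fun p ↦ ?_)
  have hd := mvfderiv_inv_eq (I := I) ((hF p).mdifferentiableAt (by simp))
    ((hFinv p).mdifferentiableAt (by simp)) hne
  have key : (ofRiemannian h).innerDual p (mvfderiv I F p).toLinearMap
      (mvfderiv I (fun q ↦ (F q)⁻¹) p).toLinearMap =
      -((F p)⁻¹ * (F p)⁻¹) * (ofRiemannian h).innerDual p (mvfderiv I F p).toLinearMap
        (mvfderiv I F p).toLinearMap := by
    rw [hd, PseudoRiemannianMetric.innerDual, PseudoRiemannianMetric.innerDual,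
      ContinuousLinearMap.toLinearMap_smul, map_smul, map_smul, smul_eq_mul]
  simp only [key]
  ring

/-- **`0 ≤ ∫ H Δ(H⁻¹)`** on a closed Riemannian manifold, for `H ∈ C²(N)` nowhere zero — the
sign information `∫ −2HΔ(H⁻¹) = −2∫|DH|²/H² ≤ 0` used in Huisken–Ilmanen's Monotonicity
Calculation (J. Differential Geom. 59 (2001), §5), which is hypothesis (F4) of
`IsClassicalIMCF.hasDerivAt_sqMeanCurvatureIntegral_le` (`GerochMonotonicityProofs.lean`).
[cite: HuiskenIlmanenIMCF2001, §5 Monotonicity Calculation (integration by parts)] -/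
theorem integral_mul_dalembertian_inv_nonneg {F : N → ℝ} (hF : CMDiff 2 F) (hne : ∀ q, F q ≠ 0) :
    0 ≤ ∫ p, F p * (ofRiemannian h).dalembertian (fun q ↦ (F q)⁻¹) p ∂riemannianMeasure h := by
  rw [integral_mul_dalembertian_inv_eq h hF hne]
  exact integral_nonneg fun p ↦ mul_nonneg (mul_self_nonneg _) (innerDual_self_nonneg h p _)

omit [I.Boundaryless] [CompactSpace N] [T2Space N] [(ofRiemannian h).HasLeviCivita] in
/-- For a manifold modelled on `ℝ^m`, the Riemannian measure is the `m`-dimensional Riemannian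
volume (`finrank ℝ ℝ^m = m`); in particular for surfaces it is the area measure
`riemannianVolume h 2` entering `hawkingMass`. [folklore] -/
theorem riemannianMeasure_eq_riemannianVolume [T3Space N] :
    riemannianMeasure h = riemannianVolume h m := by
  rw [riemannianMeasure, finrank_euclideanSpace_fin]

end Core

end Literature.Geometry.Lorentzian

end
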